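import Mathlib

/-!
# HodgeLocus census — GK wild corner ℓ = 3: singular-moduli anchors (engine A, gen 37)

Honest framing: certified instances and evidence bearing on the general Hodge conjecture; no claim.
These are the exact polynomial identities behind DERIVATION-GK-A.md §5j(f)(c): on `X₀(3)` with
Hauptmodul `t` and `j = (t+27)(t+243)^3/t^3`, the value `t = -27` is the point `j = 0`
(discriminant `-3`) and `t = 27` is the Fricke fixed point with `j = 54000 = 2^4·3^3·5^3`
(discriminant `-12`); hence `τ ± 1 = (t ∓ (∓27))/27` are differences of singular moduli of the
level-3 Hauptmodul.  Also recorded: the square structure of `j - 1728` on `X₀(3)` and the level-9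
cube relation; and the valuation / leading-term arithmetic of the derived laws D1, D1⁺ (type ζ₃ genus
asymmetry).  Pure arithmetic; nothing here is a statement about Hodge classes.
-/

set_option linter.dupNamespace false

namespace Summit.HodgeConjecture.HodgeConjecture.HodgeLocus.Census.GKSingularModuliAnchors

/-- `j(t) = (t+27)(t+243)^3/t^3` evaluated at the Fricke fixed point `t = 27` is `54000`. -/
theorem j_at_t27 : ((27:ℚ) + 27) * ((27:ℚ) + 243) ^ 3 / (27:ℚ) ^ 3 = 54000 := by norm_num

/-- … and at `t = -27` it is `0` (the CM point of discriminant `-3`). -/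
theorem j_at_tneg27 : ((-27:ℚ) + 27) * ((-27:ℚ) + 243) ^ 3 / (-27:ℚ) ^ 3 = 0 := by norm_num

/-- `54000 = 2^4 · 3^3 · 5^3` (`= j` of discriminant `-12`). -/
theorem fiftyfour_thousand : (54000:ℕ) = 2 ^ 4 * 3 ^ 3 * 5 ^ 3 := by norm_num

/-- The two Fricke fixed values: `t·(729/t) = 729` has the solutions `t = ±27` of `t^2 = 729`. -/
theorem fricke_fixed (t : ℚ) : t ^ 2 - 729 = (t - 27) * (t + 27) := by ring

/-- On `X₀(3)`, `j - 1728` is a perfect square up to the cusp factor `t^3`. -/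
theorem j_minus_1728 (t : ℚ) :
    (t + 27) * (t + 243) ^ 3 - 1728 * t ^ 3 = (t ^ 2 - 486 * t - 19683) ^ 2 := by ring

/-- `19683 = 3^9` and `486 = 2·3^5` (the constants in `j - 1728`). -/
theorem j1728_consts : (19683:ℕ) = 3 ^ 9 ∧ (486:ℕ) = 2 * 3 ^ 5 := by norm_num

/-- Level-9 cube relation: if `t = γ^3 + 9γ^2 + 27γ` then `t + 27 = (γ+3)^3`, i.e.
`τ + 1 = ((γ+3)/3)^3` for `τ = t/27`. -/
theorem level9_cube (g : ℚ) : (g ^ 3 + 9 * g ^ 2 + 27 * g) + 27 = (g + 3) ^ 3 := by ring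

/-- The same relation for `τ = t/27`: `τ + 1 = ((γ+3)/3)^3`. -/
theorem level9_cube_tau (g : ℚ) : (g ^ 3 + 9 * g ^ 2 + 27 * g) / 27 + 1 = ((g + 3) / 3) ^ 3 := by ring

/-- The shifts used by IMPL-2: roots of `T(x+1)` are `τ-1`, roots of `T(x-1)` are `τ+1`
(recorded as the trivial identities they are). -/
theorem shift_roots (τ : ℚ) : (τ - 1) + 1 = τ ∧ (τ + 1) - 1 = τ := by constructor <;> ring

/-! ## D1 / D1⁺ arithmetic (DERIVATION-GK-A §5j(f)(b), PREREG-P37 §8.4/§8.7)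
`p` plays the role of `π = √D` with `π^2 = D = -3 m′`; valuations are bookkept as rationals. -/

/-- D1 valuation bookkeeping: if `a·b = w^3` with `v(a) = 0` and `v(w) ∈ ½ℤ` then `v(b) ∈ (3/2)ℤ`. -/
theorem d1_lattice (va vb vw : ℚ) (k : ℤ) (h : va + vb = 3 * vw) (ha : va = 0) (hw : vw = k / 2) :
    vb = 3 * k / 2 := by
  rw [hw, ha] at h; linarith

/-- `1 - π^2 = 1 + 3m′` when `π^2 = -3m′` (the factor in `τ+1 ≡ π^3 y (1 - π^2)`). -/
theorem one_sub_pi_sq {R : Type*} [CommRing R] (m p : R) (hp : p ^ 2 = -3 * m) :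
    1 - p ^ 2 = 1 + 3 * m := by
  rw [hp]; ring

/-- `π^6 = -27 m′^3`. -/
theorem pi_pow_six {R : Type*} [CommRing R] (m p : R) (hp : p ^ 2 = -3 * m) :
    p ^ 6 = -27 * m ^ 3 := by
  have h : p ^ 6 = (p ^ 2) ^ 3 := by ring
  rw [h, hp]; ring

/-- D1⁺ leading term: with `y^2 = -1` (`y ∈ {±i}`), `(π^3 y (1+3m′))^2 = 27 · m′^3 (1+3m′)^2`,
i.e. `u = (τ+1)^2/27 ≡ m′^3 (1+3m′)^2` at leading order. -/
theorem d1plus_leading {R : Type*} [CommRing R] (m p y : R) (hp : p ^ 2 = -3 * m) (hy : y ^ 2 = -1) :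
    (p ^ 3 * y * (1 + 3 * m)) ^ 2 = 27 * (m ^ 3 * (1 + 3 * m) ^ 2) := by
  have h : (p ^ 3 * y * (1 + 3 * m)) ^ 2 = (p ^ 2) ^ 3 * y ^ 2 * (1 + 3 * m) ^ 2 := by ring
  rw [h, hp, hy]; ring

/-- Why the factor `(1+3m′)^2` is visible at order `3/2`: for `m′ ≡ 1 (mod 3)`,
`m′^3 (1+3m′)^2 - m′^3 = 6m′^4 + 9m′^5` has 3-adic valuation exactly 1 (nonzero mod 9, zero mod 3). -/
theorem d1plus_correction_val : ∀ m : ZMod 9, m.val % 3 = 1 →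
    (m ^ 3 * (1 + 3 * m) ^ 2 - m ^ 3 ≠ 0 ∧ 3 * (m ^ 3 * (1 + 3 * m) ^ 2 - m ^ 3) = 0) := by decide

/-- The correction term expanded: `m′^3(1+3m′)^2 - m′^3 = 6m′^4 + 9m′^5`. -/
theorem d1plus_correction_expand {R : Type*} [CommRing R] (m : R) :
    m ^ 3 * (1 + 3 * m) ^ 2 - m ^ 3 = 6 * m ^ 4 + 9 * m ^ 5 := by ring

end Summit.HodgeConjecture.HodgeConjecture.HodgeLocus.Census.GKSingularModuliAnchors
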